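import Summits.QuantumFields.YangMills.Theorems.ColdExitSC.Negative.UniformExitFalseOfHeavyTwistExtras
import Summits.QuantumFields.YangMills.Theorems.ColdExitSC.Negative.UniformExitFalseOfHeavyTwistHeadline
import Summits.QuantumFields.YangMills.Theorems.BalabanLadderIRPinnedExit96
import HarnessLib

/-!
# Line `heavy-twist` (ym-ir-idea-10, lens «negation») — rev 6: THIN BILL over the LANDED Theorems files

All content of revs 1–5 (the twisted cold box, the two-sector inequality, S1 for every central twist, the SU(2) class level, RUNG 2 =
the №24 window shape with the parity loophole closed at `θ = 1/24`, the PX-squeeze, RUNG 3 typed, the twist eater) now lives SORRY-FREE in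
`Theorems/ColdExitSC/Negative/UniformExitFalseOfHeavyTwist.lean` (core) → `…Window.lean` (RUNG 2) → `…Extras.lean`, namespace
`Summit.QuantumFields.YangMills.Theorems.ColdExitSC.Negative.HeavyTwist` (p618464 / p619623 / p621132, landed via LEAD ab-p1, say-so
2026-08-28T08:45:49Z; critic of record ym-ir-crit-3 PASS-AS-WALL) → `…Headline.lean` (p621160).  This workfile keeps ONLY: the line's one own
stub S2 `HeavyTwistSU2`, the slot of record's stubs `PX`, `N` by name, the bill `IR_of_stubs := PinnedExit96.IR_of PX N` (width of this line
toward `IR`/`IRcof`: ZERO — a wall), and the kernel-checked readings of the wall.  THE WINDOW IS A THEOREM: the wall seat ym-ir-wall-p1's engine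
`HeavyTwistWall.twistRatio_le_of_rate` (`Theorems/BalabanLadderIRHeavyTwistWallWindow.lean`, p618162, group-general) and its SU(2) instance
`HeavyTwistWall.twistWindow_SU2` (`Theorems/BalabanLadderIRHeavyTwistWall.lean`, p619584) give `TwistWindowSU2 204 (9/10)`; with the tree's
`simplyConnectedSpace_su2` the HEADLINE `¬ UniformExit24` is UNCONDITIONAL (`not_uniformExit24_holds`, Headline file; re-exported below as
`not_uniformExit24`, axioms propext / Classical.choice / Quot.sound).
F5 (lens «negation»): the RUNG-2 wall is GROUP-BLIND (it holds verbatim for U(1)₄ in real form) — selector information, never a confinement-separating ingredient.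

HONEST FRAMING: nothing here proves `BalabanLadder.IR` (stmt-QuantumFields-19354) or `IRcof` (stmt-QuantumFields-26930) — both 0/1 — or the
Yang–Mills mass gap (Clay); R4 closes only the conditional finite-𝕋⁴ rung `BalabanLadder.UV`.
-/

set_option autoImplicit false

noncomputable section

open Filter Topology
open Literature.MathematicalPhysics.QuantumFieldTheory Literature.MathematicalPhysics.QuantumLattice
open Summit.QuantumFields.YangMills.Cruxes.IR.ColdPressurePincer (IRnsc)
open Summit.QuantumFields.YangMills.Cruxes.IR.BasinRung (ColdExitAt)
open Summit.QuantumFields.YangMills.Cruxes.IR.PinnedExit96 (PinnedExitAt)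
open Summit.QuantumFields.YangMills.Theorems.ColdExitSC.Negative.HeavyTwist

namespace Summit.QuantumFields.YangMills.Cruxes.IR.HeavyTwist

/-! ## §4 Stubs of this line (S1 is a THEOREM in the core file; S2 is the line's only own stub) and the bill of record -/

/-- FORMER STUB S1 — a theorem of the landed core file (`purityTwistBoundSU2_holds`, from idea-9's `TwistCost.half_twist_cost_le_coldDefect`). Name kept. -/
theorem stub_purityTwistBound : PurityTwistBoundSU2 :=
  purityTwistBoundSU2_holds

/-- STUB S2 (finite-dimensional Laplace asymptotics at fixed lattice; the line's genuinely new obligation; odd boxes / `θ < 1/2`; OUTSIDE the reach of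
the rung-2 architecture at every β — its `1 − ẑ` bound is capped by `1/(2N²)`, eng-4 E4-P6 A1). -/
theorem stub_heavyTwist : HeavyTwistSU2 := by
  sorry

/-- STUB `PX` = `PinnedExit96.PinnedExitAt (1/24)` — the LEAD's slot of record on 19354, by name (untouched by this line). -/
theorem stub_pinnedExit96 : PinnedExitAt (1 / 24) := by
  sorry

/-- STUB `N` = `ColdPressurePincer.IRnsc`, by name. -/
theorem stub_irnsc : IRnsc := by
  sorry

/-- The leaf BY NAME through the bill of record (width of this line toward `IR`: zero — it is a wall). -/
theorem IR_of_stubs : Summit.QuantumFields.YangMills.Theses.BalabanLadder.IR :=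
  PinnedExit96.IR_of stub_pinnedExit96 stub_irnsc

/-! ## §5 Kernel-checked readings of the wall (all by name from the landed files) -/

/-- S2's reading (what the stub still buys beyond the landed headline): `¬ UniformExitAt θ` for EVERY `θ < 1/2` (odd boxes included), unconditional in π₁. -/
theorem not_uniformExitAt_of_S2 {θ : ℝ} (hθ : θ < 1 / 2) : ¬ UniformExitAt θ :=
  not_uniformExitAt_of_heavyTwistSU2 stub_heavyTwist
    Summit.QuantumFields.YangMills.Theorems.BrascampLiebVacuumSC.Negative.simplyConnectedSpace_su2 hθ

/-- **THE WINDOW OF RECORD IS A THEOREM** (wall seat ym-ir-wall-p1 W1–W6, `HeavyTwistWall.twistWindow_SU2`, p619584; engine `twistRatio_le_of_rate`,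
group-general): `TwistWindowSU2 204 (9/10)` — by name from the landed Headline file (`twistWindowSU2_holds`). -/
theorem twistWindowSU2_ofRecord : TwistWindowSU2 204 (9 / 10) :=
  twistWindowSU2_holds

/-- **HEADLINE OF THE LINE — UNCONDITIONAL** (landed `Theorems/ColdExitSC/Negative/UniformExitFalseOfHeavyTwistHeadline.lean`, by name): the β-UNIFORM
exit form of the seed of record is FALSE, `¬ UniformExit24` — no hypothesis, no `sorry` upstream (axioms propext / Classical.choice / Quot.sound;
π₁(SU(2)) = 1 from the tree's `simplyConnectedSpace_su2`).  The seed `ColdExitAt (1/24)`, K1, PX, `IR`, `IRcof` are untouched; width ZERO; group-blind (F5). -/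
theorem not_uniformExit24 : ¬ UniformExit24 :=
  not_uniformExit24_holds

/-- RUNG 2 over a window hypothesis of any slope (kept for other `κ`): `TwistWindowSU2 κ (9/10)` ⇒ `¬ UniformExit24`, parity-free. -/
theorem not_uniformExit24_of_rung2 {κ : ℝ} (hW : TwistWindowSU2 κ (9 / 10)) : ¬ UniformExit24 :=
  not_uniformExit24_of_window hW Summit.QuantumFields.YangMills.Theorems.BrascampLiebVacuumSC.Negative.simplyConnectedSpace_su2

/-- RUNG 2, selector form: the window ⇒ every exit selector of `E(1/24)` at `SU(2)` has `L(β) > β/κ` eventually (all parities). -/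
theorem selector_linear_growth_of_rung2 {κ : ℝ} (hW : TwistWindowSU2 κ (9 / 10)) (Lsel : ℝ → ℕ)
    (h8 : ∀ᶠ β : ℝ in atTop, 8 ≤ Lsel β)
    (hpure : letI : MeasurableSpace (Matrix.specialUnitaryGroup (Fin 2) ℂ) := borel _
      haveI : BorelSpace (Matrix.specialUnitaryGroup (Fin 2) ℂ) := ⟨rfl⟩
      ∀ᶠ β : ℝ in atTop, Summit.QuantumFields.YangMills.Cruxes.IR.ColdPurityBridge.coldDefect (fundamentalLatticeRep 2).ρ β (Lsel β) ≤ 1 / 24) :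
    ∀ᶠ β : ℝ in atTop, β / κ < (Lsel β : ℝ) :=
  selector_linear_growth_of_window hW le_rfl tolerance_of_record_clears Lsel h8 hpure

/-- Selector form of the headline (unconditional, landed Headline file by name): every exit selector of `E(1/24)` at `SU(2)` has `L(β) > β/204`
eventually, ALL parities. -/
example := @selector_linear_growth_holds

-- PX-squeeze (Extras file, by name): PX ∧ window ⇒ along PX's witnesses `a(β)·β < κ·T` — `unitMap_decay_of_pinnedExit`.
example := @unitMap_decay_of_pinnedExit

/-- The seed survives only with DIVERGING witnesses below tolerance ½ at `SU(2)` (S2): `UniformExitAt θ` fails while `ColdExitAt θ ← UniformExitAt θ`. -/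
theorem uniform_vs_seed {θ : ℝ} (hθ : θ < 1 / 2) :
    ¬ UniformExitAt θ ∧ (UniformExitAt θ → ColdExitAt θ) :=
  ⟨not_uniformExitAt_of_S2 hθ, coldExitAt_of_uniformExitAt⟩

end Summit.QuantumFields.YangMills.Cruxes.IR.HeavyTwist

end
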